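import Summits.BirchSwinnertonDyer.BirchSwinnertonDyer.Theorems.CumulativeHeegnerLeopoldtCumulativeHeegnerInclusionAtThreeStubResidualSelmerFiniteLineDeterminant
import HarnessLib

/-!
# Crux K1 `CumulativeHeegnerInclusionAtThree` (stmt-BirchSwinnertonDyer-24198), line `birth` v4 — STUB D
# `stub_lineDeterminantAtThree`: the determinant on a `Γ_K`-stable line of `E[3]`

Width seat bsd-line-chl-k1-p1-w2 (`--supports stmt-BirchSwinnertonDyer-24198`). The lead's
`…B1OfPrint.stub_residualSelmerFinite_of_print` (p613183) reduces STUB B1 to the Literature named fact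
`CastellaGrossiLeeSkinner2022.prop14_residualCharacterSelmer_finite`, the landed `…BadPlacesSplitFinite`, and ONE
kernel-size hypothesis `hdet` — «for a `Γ_K`-stable line `S ≤ E_K[3]` of order `3`, an element acting as the
integer `a` on `S` and as `d` on `E_K[3]/S` has mod-`3` cyclotomic character `a·d`». This file PROVES it, for
every prime `p` (`natCast_mul_eq_cyclotomic_of_smul_eq`) and verbatim at `p = 3` (`stub_lineDeterminantAtThree`),
from the landed core computation `…StubB1LineDeterminant.smul_sub_nsmul_mem_of_smul_sub_eq` (`det ρ̄_{E,p}(g) = ω(g)`,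
tree `det_eq_modNCyclotomicCharacter`, read on an adapted frame): `a` is a unit mod `p` (a non-zero point of the
line is not killed by `g`), so with `k' := ω(g)·a⁻¹` the core lemma says `g` acts as `k'` on `E[p]/S`; comparing
with `d` on a point of order `p` of the quotient (`#(E[p]/S) = p` since `#E[p] = p²`) gives `d ≡ k'`, i.e.
`a·d ≡ ω(g)`. THEOREMS ONLY; no definition, no `sorry`; imports no `Theses` module. BSD is not proved by any
of this. References: [SilvermanCSS1997] Ch. II §7–§8 (`det ρ̄_{E,m} = χ_m`); [CastellaGrossiLeeSkinner2022] §1.4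
(`ψ = ω φ⁻¹`, arXiv:2008.02571).
-/

set_option autoImplicit false
-- `…BirchSwinnertonDyer.BirchSwinnertonDyer.Theorems…` is the problem's mandated namespace (D-0017).
set_option linter.dupNamespace false

noncomputable section

open scoped Classical

namespace Summit.BirchSwinnertonDyer.BirchSwinnertonDyer.Theorems.CumulativeHeegnerInclusionAtThreeStubLineDeterminantAtThree

open Literature.NumberTheory.EllipticCurves Literature.NumberTheory.GaloisRepresentations
  Field WeierstrassCurve Summit.BirchSwinnertonDyer.Rank1Residual.X2.ResidualDevissageModules
  Summit.BirchSwinnertonDyer.BirchSwinnertonDyer.Theorems.CumulativeHeegnerInclusionAtThreeStubB1LineDeterminant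

section Line

variable {K : Type} [Field K] [NumberField K] (X : WeierstrassCurve K) [X.IsElliptic]
  (p : ℕ) [hp : Fact p.Prime]

/-- `#(E[p]/S) = p` for a stable line `S ≤ E[p]` of order `p` (`#E[p] = p²`). [cite: SilvermanAEC2009, III.6.4(b)] -/
theorem natCard_quot_eq (S : StableSubgroup (absoluteGaloisGroup K) (X.geomTorsion (p : ℤ)))
    (hS : Nat.card S.Sub = p) : Nat.card S.Quot = p := by
  have hpr : p.Prime := hp.out
  have hE : Nat.card (X.geomTorsion (p : ℤ)) = p ^ 2 :=
    WeierstrassCurve.card_torsionPoints_eq_sq_holds X (AlgebraicClosure K) (n := p)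
      (by exact_mod_cast hpr.ne_zero)
  have h := S.natCard_eq_mul
  rw [hE, hS, pow_two] at h
  exact (Nat.eq_of_mul_eq_mul_right hpr.pos h).symm

omit [NumberField K] [X.IsElliptic] in
/-- In a group of prime order `p` on which `g` acts both as the integer `d` and as the integer `k`,
`d ≡ k (mod p)`. [folklore] -/
theorem natCast_eq_of_smul_eq_smul {A : Type*} [AddCommGroup A] (hA : Nat.card A = p) (d k : ℕ)
    (h : ∀ y : A, d • y = k • y) : (d : ZMod p) = (k : ZMod p) := by
  have hpr : p.Prime := hp.out
  haveI : Finite A := Nat.finite_of_card_ne_zero (by rw [hA]; exact hpr.ne_zero)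
  haveI : Nontrivial A := Finite.one_lt_card_iff_nontrivial.mp (by rw [hA]; exact hpr.one_lt)
  obtain ⟨y₀, hy₀⟩ := exists_ne (0 : A)
  have hord : addOrderOf y₀ = p := by
    have hdvd : addOrderOf y₀ ∣ Nat.card A := addOrderOf_dvd_natCard y₀
    rw [hA] at hdvd
    rcases (Nat.dvd_prime hpr).mp hdvd with h1 | h1
    · exact absurd (AddMonoid.addOrderOf_eq_one_iff.mp h1) hy₀
    · exact h1
  have hz : ((d : ℤ) - (k : ℤ)) • y₀ = 0 := by
    rw [sub_zsmul, natCast_zsmul, natCast_zsmul, h y₀]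
    abel
  have hdvd : ((addOrderOf y₀ : ℕ) : ℤ) ∣ (d : ℤ) - (k : ℤ) := (addOrderOf_dvd_iff_zsmul_eq_zero).mpr hz
  rw [hord] at hdvd
  have := ((ZMod.intCast_eq_intCast_iff_dvd_sub (k : ℤ) (d : ℤ) p).mpr hdvd).symm
  simpa using this

/-- **The determinant on a stable line, all primes.** `S ≤ E[p]` a `Γ_K`-stable subgroup of order `p`; if
`g ∈ Γ_K` acts on `S` as the integer `a` and on `E[p]/S` as the integer `d`, then `a·d ≡ ω(g) (mod p)`
(`det ρ̄_{E,p} = χ_p` on an adapted frame). [cite: SilvermanCSS1997, Ch. II §7 Proposition and §8 (det ρ̄_{E,m} = χ_m)] [cite: CastellaGrossiLeeSkinner2022, §1.4 (ψ = ωφ⁻¹)] -/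
theorem natCast_mul_eq_cyclotomic_of_smul_eq
    (S : StableSubgroup (absoluteGaloisGroup K) (X.geomTorsion (p : ℤ))) (hS : Nat.card S.Sub = p)
    (g : absoluteGaloisGroup K) (a d : ℕ)
    (ha : ∀ x : S.Sub, g • x = a • x) (hd : ∀ y : S.Quot, g • y = d • y) :
    ((a * d : ℕ) : ZMod p) = ((modNCyclotomicCharacter K p g : (ZMod p)ˣ) : ZMod p) := by
  have hpr : p.Prime := hp.out
  set ω : ZMod p := ((modNCyclotomicCharacter K p g : (ZMod p)ˣ) : ZMod p) with hω
  -- `a` is a unit mod `p`: a non-zero point of the line is not killed by `g`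
  haveI : Finite S.Sub := Nat.finite_of_card_ne_zero (by rw [hS]; exact hpr.ne_zero)
  haveI : Nontrivial S.Sub := Finite.one_lt_card_iff_nontrivial.mp (by rw [hS]; exact hpr.one_lt)
  obtain ⟨m₀, hm₀⟩ := exists_ne (0 : S.Sub)
  have ha0 : (a : ZMod p) ≠ 0 := by
    intro h0
    have hpa : p ∣ a := (ZMod.natCast_eq_zero_iff a p).mp h0
    obtain ⟨hpm, -⟩ := exists_zsmul_eq_of_ne_zero X p S hS hm₀
    have ham : a • m₀ = 0 :=
      addOrderOf_dvd_iff_nsmul_eq_zero.mp ((addOrderOf_dvd_of_nsmul_eq_zero hpm).trans hpa)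
    have hg0 : g • m₀ = 0 := by rw [ha m₀, ham]
    exact hm₀ ((smul_eq_zero_iff_eq g).mp hg0)
  -- `k' := ω · a⁻¹`; the core lemma: `g` acts as `k'` on `E[p]/S`
  set k' : ℕ := (ω * (a : ZMod p)⁻¹).val with hk'
  have hkk' : (a : ZMod p) * (k' : ZMod p) = ω := by
    rw [hk', ZMod.natCast_zmod_val, mul_comm, mul_assoc, inv_mul_cancel₀ ha0, mul_one]
  have hq : ∀ y : S.Quot, g • y = k' • y := by
    intro y
    obtain ⟨P, rfl⟩ := S.proj_surjective y
    rw [S.smul_proj, ← map_nsmul, ← sub_eq_zero, ← map_sub, ← AddMonoidHom.mem_ker, S.ker_proj]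
    exact smul_sub_nsmul_mem_of_smul_sub_eq X p S hS g a k' hkk' ha P
  -- compare `d` and `k'` on the quotient of order `p`
  have hdk : (d : ZMod p) = (k' : ZMod p) :=
    natCast_eq_of_smul_eq_smul p (natCard_quot_eq X p S hS) d k' fun y ↦ by rw [← hd y, hq y]
  rw [Nat.cast_mul, hdk, hkk']

end Line

/-- **STUB D `stub_lineDeterminantAtThree` of line `birth` v4 — VERBATIM the hypothesis `hdet` of
`…B1OfPrint.stub_residualSelmerFinite_of_print`**: for a `Γ_K`-stable line `S ≤ E_K[3]` of order `3`, an element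
acting as the integer `a` on `S` and as `d` on `E_K[3]/S` has mod-`3` cyclotomic character `a·d`.
[cite: SilvermanCSS1997, Ch. II §7 Proposition and §8 (det ρ̄_{E,m} = χ_m)] -/
theorem stub_lineDeterminantAtThree :
    ∀ (K : Type) [Field K] [NumberField K] (E : WeierstrassCurve K) [E.IsElliptic]
      (S : StableSubgroup (absoluteGaloisGroup K) (E.geomTorsion ((3 : ℕ) : ℤ))),
      Nat.card S.Sub = 3 → ∀ (g : absoluteGaloisGroup K) (a d : ℕ),
        (∀ x : S.Sub, g • x = a • x) → (∀ y : S.Quot, g • y = d • y) →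
        ((a * d : ℕ) : ZMod 3) = ((modNCyclotomicCharacter K 3 g : (ZMod 3)ˣ) : ZMod 3) := by
  intro K _ _ E _ S hS g a d ha hd
  haveI : Fact (Nat.Prime 3) := ⟨Nat.prime_three⟩
  exact natCast_mul_eq_cyclotomic_of_smul_eq E 3 S hS g a d ha hd

end Summit.BirchSwinnertonDyer.BirchSwinnertonDyer.Theorems.CumulativeHeegnerInclusionAtThreeStubLineDeterminantAtThree

end
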